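import Summits.BirchSwinnertonDyer.BirchSwinnertonDyer.Theorems.SignedLowerHalvesSmallImageLowerHalfBothSignsLambdaLowerThreeNsThetaTransport
import Summits.BirchSwinnertonDyer.BirchSwinnertonDyer.Theorems.ResidualThetaTransportAtTwoResidualThetaMainConjectureAtTwoAnalyticLayerLawAtTwo
import Literature.NumberTheory.EllipticCurves.GreenbergVatsal2000.NonPrimitiveSelmerGroup
import HarnessLib

/-!
# Route `SignedLowerHalves`, crux L `SmallImageLowerHalfBothSigns` (item stmt-BirchSwinnertonDyer-23599), line `rtt_w3` v3:
# the ONE-SIDED engine Kλ₂^≥ SPLITS as (AN_W) ∧ (ENG) in GREENBERG–VATSAL CURRENCY — local terms `Σ_{v∈S₀} δ_W^{(v)}`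

LEAD `cruxlead-stmt-BirchSwinnertonDyer-23599` g0 (cell `bsd-ssimc`); ROUTE-INDEPENDENT helper (`--supports
stmt-BirchSwinnertonDyer-23599`); THEOREMS ONLY — no definition, no named fact, no `sorry`; closes nothing; BSD is not proved
by any of this.

HONEST FRAMING. Companion of `…RttEngineSplit` (p741807), which split the one-sided engine Kλ₂^≥ with the local terms read as
layer-`λ`'s of the layer-`n` Euler factors. Here the SAME split is stated with the local terms in Greenberg–Vatsal's currency
`Σ_{v∈S₀} δ_W^{(v)}` (`GreenbergVatsal2000.delta W p v = s_ℓ·d_ℓ`, Prop. (2.4); tree: `order_map_toZMod_eulerFactorProduct` gives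
`μ(∏𝒫_ℓ) = 0`, `λ(∏𝒫_ℓ) = Σ δ` at odd `p`) — the currency of the tree's named facts B. D. Kim 2009 Cor. 2.13
(`BDKim2009.cor213_signedLambda_add_sum_delta_eq_of_torsionIso`) and Hatley–Lei 2019 Thm. 4.6, so that the registered v3 stubs read:

* **(AN_W)** `λ_n(θ^{S₀}_n(f)) = λ(L^ε) + Σ_{v∈S₀} δ_W^{(v)} + deg ω_n^{−ε}` for `n ≫ 0` of the parity of `ε` (W-side layer bookkeeping:
  Pollack congruences + `𝒫^{(n)}_v ≡ 𝒫_v (mod ω_n)` + GV Prop. (2.4); KERNEL ALGEBRA);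
* **(ENG)** `λ_n(θ^{S₀}_n(g)^ι) ≤ deg ω_n^{−ε} + λ(X^ε_W) + Σ_{v∈S₀} δ_W^{(v)}` for `n ≫ 0` of the parity of `ε` (the carrier-free partner
  inequality: Pollack/PW 2011 Thm 4.1 for `g` ∧ the CM partner's main-conjecture equality direction ∧ Hatley–Lei 4.6 / Kim Cor 2.13).
  On a CM-CURVE partner `g = f_A` it is (AN_W for `A`) + Kim Cor 2.13 + Pollack–Rubin 2004, all tree named facts.

* `residualThetaMC_ge_of_anW_of_eng_delta` — per pair and sign: (AN_W) ∧ (ENG) ⟹ Kλ₂^≥ (integer arithmetic; `λ(G) = λ(L^ε)` by the tree's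
  `ResidualThetaLayer.lam_eq_of_iwasawaToPowerSeries_eq_C_mul`, `ϖ ≠ 0`).

References: [GreenbergVatsal2000] §1 (8)–(9), §2 Prop. (2.4); [BDKim2009] Prop. 2.6, Cor. 2.13; [HatleyLei2019] Thm. 4.6; [Pollack2003] Prop. 6.18;
[PollackWeston2011MT] §3.1, Thm. 4.1; [PollackRubin2004] Theorem (p. 448); [Lei2011] Cor. 6.9, §7.
-/

set_option autoImplicit false
-- D-0017: single-problem summit, the namespace repeats the problem name by design.
set_option linter.dupNamespace false
noncomputable section

open scoped Classical MatrixGroups ModularForm BigOperators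

open CongruenceSubgroup WeierstrassCurve Field Polynomial NumberField IsDedekindDomain
  Literature.NumberTheory.EllipticCurves Literature.NumberTheory.EllipticCurves.ModularForms
  Literature.NumberTheory.EllipticCurves.Rank1Residual
  Literature.NumberTheory.EllipticCurves.Kobayashi2003
  Literature.NumberTheory.EllipticCurves.GreenbergVatsal2000 ZpExtension
  Literature.NumberTheory.IwasawaTheory Rat.HeightOneSpectrum
  Summit.BirchSwinnertonDyer.Rank1Residual.Supersingular
  Summit.BirchSwinnertonDyer.Rank1Residual.X1.MuLambda
  Summit.BirchSwinnertonDyer.BirchSwinnertonDyer.Theorems.SmallImageLambdaLowerThreeNsThetaTransport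

namespace Summit.BirchSwinnertonDyer.BirchSwinnertonDyer.Theorems.SmallImageRttOneSided

section SplitDelta

variable (W : WeierstrassCurve ℚ) [W.IsElliptic] [W.IsGloballyMinimal] (p : ℕ) [Fact p.Prime]

omit [W.IsElliptic] in
/-- **The one-sided engine Kλ₂^≥ of line `rtt_w3` from (AN_W) ∧ (ENG) in Greenberg–Vatsal currency**, at a pair `(W, p)` and a sign
`ε`: GIVEN `hAN` (for the newform `f`, every Pollack pair, every finite `S₀ ∌ p`: `λ_n(θ^{S₀}_n(f)) = λ(L^ε) + Σ_{v∈S₀} δ_W^{(v)} + deg ω_n^{−ε}`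
for `n ≫ 0` of the parity of `ε`) and `hENG` (for every level-matched CM partner with cohomological period, cyclotomic `(κ, γ)`, admissible `S₀`,
signed dual datum of sign `ε`, f.g. torsion, `μ = 0`: `λ_n(θ^{S₀}_n(g)^ι) ≤ deg ω_n^{−ε} + λ(X^ε_W) + Σ_{v∈S₀} δ_W^{(v)}` for `n ≫ 0` of that
parity), the v3 engine text holds at `(W, p, ε)`: `λ_n(θ^{S₀}_n(g)) − λ_n(θ^{S₀}_n(f)) ≤ λ(X^ε_W) − λ(G)` for every `G` with
`ι G = C(p^m ϖ)·ι L^ε` and `n ≫ 0` of the parity of `ε`. Integer arithmetic; `λ(G) = λ(L^ε)` (`ϖ ≠ 0`). Nothing is asserted.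
[cite: GreenbergVatsal2000, §2 Prop. (2.4)] [cite: PollackWeston2011MT, §3.1, Thm. 4.1] [cite: HatleyLei2019, Thm. 4.6] -/
theorem residualThetaMC_ge_of_anW_of_eng_delta (ε : ℤˣ)
    (hAN : ∀ [NeZero (W.conductorNorm ℤ)] (f : CuspForm (Gamma0 (W.conductorNorm ℤ)) 2), IsNewformOf W f →
        ∀ (Lplus Lminus : IwasawaAlgebra p), IsPollackPair f p Lplus Lminus →
        ∀ (S₀ : Finset (HeightOneSpectrum (𝓞 ℚ))), (∀ v ∈ S₀, ((p : ℕ) : 𝓞 ℚ) ∉ v.asIdeal) →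
        ∃ n₀ : ℕ, ∀ n ≥ n₀, (Even n ↔ ε = 1) →
          ((layerLambda (((mazurTateElement f p n).map (algebraMap ℚ (PadicAlgCl p)) *
              ∏ v ∈ S₀, ((W.localPolynomialAt v).map (Int.castRingHom (PadicAlgCl p))).comp
                (C ((natGenerator v : PadicAlgCl p)⁻¹) *
                  (X + 1) ^ (PadicInt.toZModPow n (-(frobeniusExponent p (natGenerator v : ℤ_[p])))).val)) %ₘ
              ((X + 1) ^ p ^ n - 1)) : ℕ) : ℤ) =
            ((lam (kobayashiL ε Lplus Lminus) : ℕ) : ℤ) + ((∑ v ∈ S₀, delta W p v : ℕ) : ℤ) + ((if ε = 1 then cyclotomicOmegaMinus p n else cyclotomicOmegaPlus p n).natDegree : ℤ))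
    (hENG : ∀ (M : ℕ) [NeZero M] (g : CuspForm (Gamma0 M) 2) (ι : coeffField g →+* PadicAlgCl p) (Ω : ℂ),
        ¬ p ∣ M → (∀ ℓ : ℕ, ℓ.Prime → ℓ ≠ p → max 2 (padicValNat ℓ M) = max 2 (padicValNat ℓ (W.conductorNorm ℤ))) →
        IsNewform0 g → Literature.NumberTheory.Automorphic.IsCMForm (liftToGamma1 M 2 g) →
        cuspCoeff g p = 0 → IsCohomologicalPlusPeriod g ι Ω →
        (∀ ℓ : ℕ, ℓ.Prime → ¬ ℓ ∣ p * M * W.conductorNorm ℤ →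
          ‖embCoeff g ι ℓ - (W.frobeniusTrace ℓ : PadicAlgCl p)‖ < 1) →
        ∀ (κ : ZpExtension ℚ p) (γ : absoluteGaloisGroup ℚ),
          κ.IsCyclotomic → κ.IsTopGenerator γ → IsCyclotomicVariable p γ →
        ∀ (S₀ : Finset (HeightOneSpectrum (𝓞 ℚ))), (∀ v ∈ S₀, ((p : ℕ) : 𝓞 ℚ) ∉ v.asIdeal) →
          (∀ v : HeightOneSpectrum (𝓞 ℚ), ¬ W.HasGoodReductionAt v → v ∈ S₀) →
          (∀ v : HeightOneSpectrum (𝓞 ℚ), natGenerator v ∣ M → v ∈ S₀) →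
        ∀ (D : SignedSelmerDualData W κ γ ε) [Module.Finite (IwasawaAlgebra p) D.X],
          Module.IsTorsion (IwasawaAlgebra p) D.X → D.mu = 0 →
        ∃ n₀ : ℕ, ∀ n ≥ n₀, (Even n ↔ ε = 1) →
          ((layerLambda (((mazurTateElementK g Ω p n).map ι *
              ∏ v ∈ S₀, (1 - C (embCoeff g ι (natGenerator v)) * X +
                  (if natGenerator v ∣ M then 0 else C (natGenerator v : PadicAlgCl p)) * X ^ 2).comp
                (C ((natGenerator v : PadicAlgCl p)⁻¹) *
                  (X + 1) ^ (PadicInt.toZModPow n (-(frobeniusExponent p (natGenerator v : ℤ_[p])))).val)) %ₘ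
              ((X + 1) ^ p ^ n - 1)) : ℕ) : ℤ) ≤
            ((if ε = 1 then cyclotomicOmegaMinus p n else cyclotomicOmegaPlus p n).natDegree : ℤ) + ((lambdaInvariant p D.X : ℕ) : ℤ) + ((∑ v ∈ S₀, delta W p v : ℕ) : ℤ)) :
    ∀ (M : ℕ) [NeZero M] (g : CuspForm (Gamma0 M) 2) (ι : coeffField g →+* PadicAlgCl p) (Ω : ℂ),
        ¬ p ∣ M → (∀ ℓ : ℕ, ℓ.Prime → ℓ ≠ p → max 2 (padicValNat ℓ M) = max 2 (padicValNat ℓ (W.conductorNorm ℤ))) →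
        IsNewform0 g → Literature.NumberTheory.Automorphic.IsCMForm (liftToGamma1 M 2 g) →
        cuspCoeff g p = 0 → IsCohomologicalPlusPeriod g ι Ω →
        (∀ ℓ : ℕ, ℓ.Prime → ¬ ℓ ∣ p * M * W.conductorNorm ℤ →
          ‖embCoeff g ι ℓ - (W.frobeniusTrace ℓ : PadicAlgCl p)‖ < 1) →
        ∀ (κ : ZpExtension ℚ p) (γ : absoluteGaloisGroup ℚ),
          κ.IsCyclotomic → κ.IsTopGenerator γ → IsCyclotomicVariable p γ →
        ∀ [NeZero (W.conductorNorm ℤ)] (f : CuspForm (Gamma0 (W.conductorNorm ℤ)) 2), IsNewformOf W f →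
        ∀ (ϖ : ℚ), (ϖ : ℝ) * W.realPeriodRat = plusPeriod f →
        ∀ (Lplus Lminus : IwasawaAlgebra p), IsPollackPair f p Lplus Lminus →
        ∀ (S₀ : Finset (HeightOneSpectrum (𝓞 ℚ))), (∀ v ∈ S₀, ((p : ℕ) : 𝓞 ℚ) ∉ v.asIdeal) →
          (∀ v : HeightOneSpectrum (𝓞 ℚ), ¬ W.HasGoodReductionAt v → v ∈ S₀) →
          (∀ v : HeightOneSpectrum (𝓞 ℚ), natGenerator v ∣ M → v ∈ S₀) →
        ∀ (D : SignedSelmerDualData W κ γ ε) [Module.Finite (IwasawaAlgebra p) D.X],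
          Module.IsTorsion (IwasawaAlgebra p) D.X → D.mu = 0 →
        ∀ (G : IwasawaAlgebra p) (m : ℕ),
          iwasawaToPowerSeries p G =
            PowerSeries.C ((p : ℚ_[p]) ^ m * (ϖ : ℚ_[p])) * iwasawaToPowerSeries p (kobayashiL ε Lplus Lminus) →
        ∃ n₀ : ℕ, ∀ n ≥ n₀, (Even n ↔ ε = 1) →
          ((layerLambda (((mazurTateElementK g Ω p n).map ι *
              ∏ v ∈ S₀, (1 - C (embCoeff g ι (natGenerator v)) * X +
                  (if natGenerator v ∣ M then 0 else C (natGenerator v : PadicAlgCl p)) * X ^ 2).comp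
                (C ((natGenerator v : PadicAlgCl p)⁻¹) *
                  (X + 1) ^ (PadicInt.toZModPow n (-(frobeniusExponent p (natGenerator v : ℤ_[p])))).val)) %ₘ
              ((X + 1) ^ p ^ n - 1)) : ℕ) : ℤ) -
            ((layerLambda (((mazurTateElement f p n).map (algebraMap ℚ (PadicAlgCl p)) *
              ∏ v ∈ S₀, ((W.localPolynomialAt v).map (Int.castRingHom (PadicAlgCl p))).comp
                (C ((natGenerator v : PadicAlgCl p)⁻¹) *
                  (X + 1) ^ (PadicInt.toZModPow n (-(frobeniusExponent p (natGenerator v : ℤ_[p])))).val)) %ₘ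
              ((X + 1) ^ p ^ n - 1)) : ℕ) : ℤ) ≤
          ((lambdaInvariant p D.X : ℕ) : ℤ) - ((lam G : ℕ) : ℤ) := by
  intro M _ g ι Ω hpM hlev hnew hcm hapg hΩ hcong κ γ hκ hγ hγ' _ f hf ϖ hϖ Lplus Lminus hPP S₀ hS₀p hS₀W hS₀M D _
    hXt hμ G m hG
  obtain ⟨n₁, hn₁⟩ := hAN f hf Lplus Lminus hPP S₀ hS₀p
  obtain ⟨n₃, hn₃⟩ := hENG M g ι Ω hpM hlev hnew hcm hapg hΩ hcong κ γ hκ hγ hγ' S₀ hS₀p hS₀W hS₀M D hXt hμ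
  -- `λ(G) = λ(L^ε_W)`
  set L := kobayashiL ε Lplus Lminus with hLdef
  have hL0 : L ≠ 0 := by
    rcases Int.units_eq_one_or ε with rfl | rfl
    · simpa [hLdef, kobayashiL] using hPP.2.1
    · have : kobayashiL (-1) Lplus Lminus = Lplus := by simp [kobayashiL]
      rw [hLdef, this]; exact hPP.1
  have hϖ0 : (ϖ : ℚ_[p]) ≠ 0 := by
    exact_mod_cast Summit.BirchSwinnertonDyer.Rank1Residual.X2.varpi_ne_zero_of_isNewformOf hf hϖ
  have hx0 : (p : ℚ_[p]) ^ m * (ϖ : ℚ_[p]) ≠ 0 :=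
    mul_ne_zero (pow_ne_zero _ (by exact_mod_cast (Fact.out : p.Prime).ne_zero)) hϖ0
  have hlamG : lam G = lam L :=
    (Summit.BirchSwinnertonDyer.BirchSwinnertonDyer.Theorems.ResidualThetaLayer.lam_eq_of_iwasawaToPowerSeries_eq_C_mul
      hx0 hL0 hG).2
  refine ⟨max n₁ n₃, fun n hn hpar ↦ ?_⟩
  have hW := hn₁ n (le_of_max_le_left hn) hpar
  have h3 := hn₃ n (le_of_max_le_right hn) hpar
  rw [hW, hlamG]
  linarith

end SplitDelta

end Summit.BirchSwinnertonDyer.BirchSwinnertonDyer.Theorems.SmallImageRttOneSided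

end
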